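import Summits.BirchSwinnertonDyer.Rank1Residual.X11b.BDPFrameUniqueness
import Summits.BirchSwinnertonDyer.Rank1Residual.X11b.InterpolationCharacterSupplyShapes
import Mathlib.Analysis.Analytic.IsolatedZeros
import Mathlib.Analysis.Analytic.OfScalars
import Mathlib.Analysis.SpecificLimits.Normed
import HarnessLib

/-!
# Crux K1 `CumulativeHeegnerInclusionAtThree` (stmt-BirchSwinnertonDyer-24198), stub A = crux stmt-26896
# `TemperedHeegnerInclusionAtThree`: TEMPERED RIGIDITY — a power series over `ℂ_p` of ANY positive radius
# of convergence (in particular a tempered / `𝓗_h`-type series, coefficients `O(n^h)`) is determined by its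
# values along a sequence of points accumulating at the trivial character; hence a tempered solution of
# Castella's interpolation problem `IsBDPLFunction ι 𝔭 κ γ f Ω_K Ω_p ·` IS the bounded one

Width seat `bsd-line-chl-k1-p1-w2` (g3) of the K1 line `birth` (route `CumulativeHeegnerLeopoldt`, rev 5;
skeleton v5: K1 = stub A (research crux stmt-26896) + stub P (print stmt-26897)). Helper toward stub A,
`--supports stmt-BirchSwinnertonDyer-24198`; THEOREMS ONLY (no definition, no named fact, no `sorry`).
BSD is not proved by any of this; no summit statement is proved by this file.

## Why

The K1 lead's design datum for a re-lining of A (evidence 26896 #6, TEMPERED-LINE-VIABILITY (U2)) is that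
the receptacle of the cumulative Heegner class is TEMPERED (temper 1: `p617614`, `p622174` §6), and that an
explicit reciprocity law `Col♮(loc_𝔭 κ♮) · m = ℒ_𝔭^{BDP}` for such a class is nevertheless PINNED by its
specialisations at Castella's interpolation range (unramified Hecke characters of infinity type `(n, -n)`),
because that range accumulates in the INTERIOR of the disc — "any two analytic functions on the open disc,
bounded OR tempered of any finite order, that agree on the BDP range are equal". The tree has this only for
BOUNDED series: `X11b.eq_zero_of_norm_le_of_hasSum_zero_of_tendsto_zero` (coefficients `‖c_n‖ ≤ C`),
`X11b.unrSeries_eq_of_hasValueAt`, `X11b.isBDPLFunction_unique_of_isAnticyclotomic` (`R₀⟦T⟧`), and the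
Weierstrass-based `…UnrSeriesZeros.eq_of_infinite_hasValueAt_eq` (p618410) /
`MemIwasawaRat.eq_zero_of_forall_hasSum_zero` (`Λ ⊗ ℚ_p`); for an order-1 object the torsion points
`ζ - 1` do NOT pin it (`log(1+T)`), which is the recorded «order-1 uniqueness gap» (evidence 24198 #28 §3).
This file proves the tempered statement the lead uses: the gap does not exist at interior accumulation
points, for series of any positive radius of convergence.

## What is proved

* §1 `eq_zero_of_hasSum_zero_of_tendsto_zero'` — IDENTITY PRINCIPLE AT `0`, POSITIVE RADIUS: over a
  complete nontrivially normed field `𝕜`, if `‖c_n‖ ρ^n ≤ C` for some `ρ > 0` and `∑ c_n x_k^n = 0` for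
  infinitely many `k` along a sequence `x_k → 0`, `x_k ≠ 0`, then `c = 0` (isolated zeros of the analytic
  sum, radius `≥ ρ`; same mechanism as the bounded `X11b` lemma, whose hypothesis `‖c_n‖ ≤ C` is `ρ = 1`);
  `eq_of_hasSum_eq_of_tendsto_zero` — two such series with equal values along the sequence are equal.
* §2 `exists_norm_mul_pow_le_of_norm_le_mul_pow` — TEMPERED ⟹ every radius `ρ < 1`: `‖c_n‖ ≤ C (n+1)^h`
  gives `‖c_n‖ ρ^n ≤ C_ρ` for every `0 ≤ ρ < 1` (Perrin-Riou's `𝓗_h` growth; the cumulative class has `h = 1`).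
* §3 AT THE BDP FRAME (odd `p`, `K` imaginary quadratic, `κ` anticyclotomic with topological generator `γ`,
  any `ι, 𝔭, f, Ω_K, Ω_p`), fed with the tree's character supply `X11b.exists_interpolationSupply`:
  **`eq_coeff_of_isBDPLFunction_of_hasSum`** — if `L ∈ R₀⟦T⟧` has `IsBDPLFunction ι 𝔭 κ γ f Ω_K Ω_p L` and a
  series `c` over `ℂ_p` of positive radius `ρ` takes Castella's value
  `ι⁻¹(bdpInterpolationValue p f 𝔭 φ n Ω_K) · Ω_p^{4n}` at every interpolation point `φ̂(γ) - 1` of norm `< ρ`,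
  then `c_n = [Tⁿ]L` for all `n` (so `c` is bounded with coefficients in `R₀`);
  `eq_of_hasSum_bdpRange` — two positive-radius series taking equal values at every interpolation point
  inside both discs of convergence are equal (no `L` needed).

WHAT THIS DOES NOT DO: no tempered class, Coleman map or reciprocity law is constructed; nothing is said
about points that do not accumulate at an interior point (for the closed-disc count see Strassmann's
theorem, Cassels Ch. 4 Thm. 4.1, not needed here); frames with different periods are the business of
`…StubE1BOfOne.span_eq_span_of_isBDPLFunction` (bounded) and are not compared here.

References: [Cassels1986] J. W. S. Cassels, *Local Fields*, LMS Student Texts 3 (1986), Ch. 4 Thm. 4.1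
(Strassmann) and the isolated-zeros principle; [Castella2018] Thm. 3.1 (arXiv:1704.06608 p. 9);
[PerrinRiou1994Invent] B. Perrin-Riou, *Théorie d'Iwasawa des représentations p-adiques sur un corps local*,
Invent. Math. 115 (1994), §1 (the algebras `𝓗_h`); [Greenberg1987] §2 (supply of anticyclotomic characters).
-/

noncomputable section

-- D-0017: single-problem summit, `Summit.BirchSwinnertonDyer.BirchSwinnertonDyer.…` repeats a namespace BY DESIGN.
set_option linter.dupNamespace false
set_option autoImplicit false

open scoped Classical Topology ENNReal NNReal

open Filter NumberField IsDedekindDomain Field PowerSeries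
open Literature.NumberTheory.EllipticCurves
open Literature.NumberTheory.GaloisRepresentations
open Summit.BirchSwinnertonDyer.Rank1Residual.X11b
open Summit.BirchSwinnertonDyer.Rank1Residual.X11b.Halves

namespace Summit.BirchSwinnertonDyer.BirchSwinnertonDyer.Theorems.CumulativeHeegnerInclusionAtThreeTemperedRigidity

/-! ### §1 Identity principle at `0` for power series of positive radius -/

section Identity

variable {𝕜 : Type*} [NontriviallyNormedField 𝕜] [CompleteSpace 𝕜]

/-- **Identity principle at `0`, positive radius of convergence.** Over a complete nontrivially normed
field `𝕜` (e.g. `ℂ_p`): if `‖c_n‖ ρ^n ≤ C` for some `ρ > 0` (radius of convergence `≥ ρ`; a TEMPERED series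
over `ℂ_p` has this for every `ρ < 1`, §2) and, along a sequence `x_k → 0`, for infinitely many `k` both
`x_k ≠ 0` and `∑_n c_n x_k^n = 0`, then every `c_n` is `0`. Proof: `z ↦ ∑ c_n z^n` is analytic on the ball of
radius `ρ`, vanishes frequently on the punctured neighbourhood of `0`, hence near `0` (isolated zeros), so
its series at `0` is zero. The bounded case `ρ = 1` is `X11b.eq_zero_of_norm_le_of_hasSum_zero_of_tendsto_zero`.
[cite: Cassels1986, Ch. 4 Thm. 4.1 (Strassmann) — here the isolated-zeros variant at an interior accumulation point] -/
theorem eq_zero_of_hasSum_zero_of_tendsto_zero' {c : ℕ → 𝕜} {ρ C : ℝ} (hρ : 0 < ρ)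
    (hc : ∀ n, ‖c n‖ * ρ ^ n ≤ C) {x : ℕ → 𝕜} (hx : Tendsto x atTop (𝓝 0))
    (h : ∃ᶠ k in atTop, x k ≠ 0 ∧ HasSum (fun n ↦ c n * x k ^ n) 0) : c = 0 := by
  let P : FormalMultilinearSeries 𝕜 𝕜 𝕜 := FormalMultilinearSeries.ofScalars 𝕜 c
  set ρ' : ℝ≥0 := ⟨ρ, hρ.le⟩ with hρ'
  -- radius ≥ ρ from the bound on the coefficients
  have hrad : ((ρ' : ℝ≥0) : ℝ≥0∞) ≤ P.radius := by
    refine P.le_radius_of_bound C fun n ↦ ?_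
    rw [FormalMultilinearSeries.ofScalars_norm]
    exact hc n
  have hρ'0 : (0 : ℝ≥0∞) < ρ' := by
    rw [ENNReal.coe_pos]
    exact_mod_cast hρ
  have hpos : 0 < P.radius := lt_of_lt_of_le hρ'0 hrad
  have hP : HasFPowerSeriesOnBall P.sum P 0 P.radius := P.hasFPowerSeriesOnBall hpos
  -- the sum vanishes at every zero `x_k` of norm `< ρ`
  have hval : ∀ k, ‖x k‖ < ρ → HasSum (fun n ↦ c n * x k ^ n) 0 → P.sum (x k) = 0 := by
    intro k hk h0
    have hy : x k ∈ Metric.eball (0 : 𝕜) P.radius := by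
      refine lt_of_lt_of_le ?_ hrad
      rw [edist_zero_right, enorm_eq_nnnorm, ENNReal.coe_lt_coe, ← NNReal.coe_lt_coe, coe_nnnorm]
      exact hk
    have h1 : HasSum (fun n ↦ P n fun _ ↦ x k) (P.sum (x k)) := by
      simpa only [zero_add] using hP.hasSum hy
    have h2 : HasSum (fun n ↦ P n fun _ ↦ x k) 0 := by
      have hfun : (fun n ↦ P n fun _ ↦ x k) = fun n ↦ c n * x k ^ n := by
        funext n
        rw [FormalMultilinearSeries.ofScalars_apply_eq, smul_eq_mul]
      rw [hfun]
      exact h0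
    exact h1.unique h2
  -- hence it vanishes frequently on the punctured neighbourhood of `0`
  have hev1 : ∀ᶠ k in atTop, ‖x k‖ < ρ := by
    have hball : Metric.ball (0 : 𝕜) ρ ∈ 𝓝 (0 : 𝕜) := Metric.ball_mem_nhds 0 hρ
    filter_upwards [hx.eventually hball] with k hk
    simpa [Metric.mem_ball, dist_zero_right] using hk
  have hfreq' : ∃ᶠ k in atTop, P.sum (x k) = 0 ∧ x k ∈ ({0}ᶜ : Set 𝕜) := by
    refine (h.and_eventually hev1).mono ?_
    rintro k ⟨⟨hk0, hk⟩, hk1⟩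
    exact ⟨hval k hk1 hk, hk0⟩
  have hfreq : ∃ᶠ z in 𝓝[≠] (0 : 𝕜), P.sum z = 0 := by
    rw [frequently_nhdsWithin_iff]
    exact hx.frequently hfreq'
  -- isolated zeros: it vanishes near `0`, so its power series at `0` is zero
  have hev : ∀ᶠ z in 𝓝 (0 : 𝕜), P.sum z = 0 :=
    hP.analyticAt.frequently_zero_iff_eventually_zero.mp hfreq
  have h0 : HasFPowerSeriesAt (0 : 𝕜 → 𝕜) P 0 :=
    hP.hasFPowerSeriesAt.congr (hev.mono fun z hz ↦ by rw [hz, Pi.zero_apply])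
  have hP0 : P = 0 := h0.eq_zero
  exact (FormalMultilinearSeries.ofScalars_series_eq_zero 𝕜).mp hP0

/-- The same in the binder shape of `X11b.eq_zero_of_norm_le_of_hasSum_zero_of_tendsto_zero` (`x_k ≠ 0`
infinitely often, the series vanishes at EVERY `x_k`), for coefficients of positive radius `ρ` instead of
bounded ones. [cite: Cassels1986, Ch. 4 Thm. 4.1 (Strassmann; isolated-zeros variant)] -/
theorem eq_zero_of_hasSum_zero_of_tendsto_zero {c : ℕ → 𝕜} {ρ C : ℝ} (hρ : 0 < ρ)
    (hc : ∀ n, ‖c n‖ * ρ ^ n ≤ C) {x : ℕ → 𝕜} (hx : Tendsto x atTop (𝓝 0))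
    (hx0 : ∃ᶠ k in atTop, x k ≠ 0) (h : ∀ k, HasSum (fun n ↦ c n * x k ^ n) 0) : c = 0 :=
  eq_zero_of_hasSum_zero_of_tendsto_zero' hρ hc hx (hx0.mono fun k hk ↦ ⟨hk, h k⟩)

omit [CompleteSpace 𝕜] in
/-- A bound `‖c_n‖ ρ^n ≤ C` persists at every smaller radius `0 ≤ ρ₀ ≤ ρ`. [folklore] -/
theorem norm_mul_pow_le_of_le {c : ℕ → 𝕜} {ρ ρ₀ C : ℝ} (hρ₀ : 0 ≤ ρ₀) (hle : ρ₀ ≤ ρ)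
    (hc : ∀ n, ‖c n‖ * ρ ^ n ≤ C) (n : ℕ) : ‖c n‖ * ρ₀ ^ n ≤ C :=
  (mul_le_mul_of_nonneg_left (pow_le_pow_left₀ hρ₀ hle n) (norm_nonneg _)).trans (hc n)

/-- **Two series of positive radius with the same values along a sequence accumulating at `0` are
equal.** If `‖c_n‖ ρ^n ≤ C` and `‖c'_n‖ ρ'^n ≤ C'` (`ρ, ρ' > 0`), `x_k → 0`, and for infinitely many `k`
both `x_k ≠ 0` and `∑ c_n x_k^n = ∑ c'_n x_k^n` (a common `HasSum` value), then `c = c'`.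
[cite: Cassels1986, Ch. 4 Thm. 4.1 (Strassmann; isolated-zeros variant)] -/
theorem eq_of_hasSum_eq_of_tendsto_zero {c c' : ℕ → 𝕜} {ρ C ρ' C' : ℝ} (hρ : 0 < ρ)
    (hc : ∀ n, ‖c n‖ * ρ ^ n ≤ C) (hρ' : 0 < ρ') (hc' : ∀ n, ‖c' n‖ * ρ' ^ n ≤ C')
    {x : ℕ → 𝕜} (hx : Tendsto x atTop (𝓝 0))
    (h : ∃ᶠ k in atTop, x k ≠ 0 ∧ ∃ v, HasSum (fun n ↦ c n * x k ^ n) v ∧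
      HasSum (fun n ↦ c' n * x k ^ n) v) : c = c' := by
  have hmin : 0 < min ρ ρ' := lt_min hρ hρ'
  have hbd : ∀ n, ‖(c - c') n‖ * (min ρ ρ') ^ n ≤ C + C' := by
    intro n
    rw [Pi.sub_apply]
    calc ‖c n - c' n‖ * (min ρ ρ') ^ n ≤ (‖c n‖ + ‖c' n‖) * (min ρ ρ') ^ n :=
          mul_le_mul_of_nonneg_right (norm_sub_le _ _) (pow_nonneg hmin.le _)
      _ = ‖c n‖ * (min ρ ρ') ^ n + ‖c' n‖ * (min ρ ρ') ^ n := by ring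
      _ ≤ C + C' := add_le_add (norm_mul_pow_le_of_le hmin.le (min_le_left _ _) hc n)
          (norm_mul_pow_le_of_le hmin.le (min_le_right _ _) hc' n)
  have key : c - c' = 0 := by
    refine eq_zero_of_hasSum_zero_of_tendsto_zero' hmin hbd hx (h.mono ?_)
    rintro k ⟨hk0, v, hv, hv'⟩
    refine ⟨hk0, ?_⟩
    have hsub := hv.sub hv'
    rw [sub_self] at hsub
    refine hsub.congr_fun fun n ↦ ?_
    rw [Pi.sub_apply, sub_mul]
  exact sub_eq_zero.mp key

end Identity

/-! ### §2 Tempered series have every radius `ρ < 1` -/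

section Tempered

variable {𝕜 : Type*} [NontriviallyNormedField 𝕜]

/-- **A tempered series converges on the open unit disc, with a bound on every closed sub-disc**: if
`‖c_n‖ ≤ C (n + 1)^h` (growth of order `h`, Perrin-Riou's `𝓗_h`; the cumulative Heegner class has `h = 1`),
then for every `0 ≤ ρ < 1` there is `C_ρ` with `‖c_n‖ ρ^n ≤ C_ρ` for all `n` (`(n+1)^h ρ^n → 0`). In
particular such a `c` satisfies the positive-radius hypothesis of §1 at every `0 < ρ < 1`.
[cite: PerrinRiou1994Invent, §1.1 (the algebras 𝓗_h of tempered distributions)] -/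
theorem exists_norm_mul_pow_le_of_norm_le_mul_pow {c : ℕ → 𝕜} {C : ℝ} {h : ℕ}
    (hc : ∀ n, ‖c n‖ ≤ C * ((n : ℝ) + 1) ^ h) {ρ : ℝ} (hρ0 : 0 ≤ ρ) (hρ1 : ρ < 1) :
    ∃ Cρ : ℝ, ∀ n, ‖c n‖ * ρ ^ n ≤ Cρ := by
  -- the sequence `(n+1)^h ρ^n` tends to `0`, hence is bounded
  have hlim : Tendsto (fun n : ℕ ↦ ((n : ℝ) + 1) ^ h * ρ ^ n) atTop (𝓝 0) := by
    rcases hρ0.eq_or_lt with hρ | hρ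
    · rw [← hρ]
      refine tendsto_atTop_of_eventually_const (i₀ := 1) fun n hn ↦ ?_
      rw [zero_pow (by omega), mul_zero]
    · have h1 : Tendsto (fun m : ℕ ↦ (m : ℝ) ^ h * ρ ^ m) atTop (𝓝 0) :=
        tendsto_pow_const_mul_const_pow_of_abs_lt_one h (by rwa [abs_of_pos hρ])
      have h2 : Tendsto (fun n : ℕ ↦ ((((n + 1 : ℕ) : ℝ)) ^ h * ρ ^ (n + 1)) * ρ⁻¹) atTop (𝓝 0) := by
        have := (h1.comp (tendsto_add_atTop_nat 1)).mul_const ρ⁻¹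
        rwa [zero_mul] at this
      refine h2.congr fun n ↦ ?_
      rw [pow_succ, Nat.cast_add, Nat.cast_one]
      field_simp
  obtain ⟨B, hB⟩ := hlim.bddAbove_range
  have hC0 : 0 ≤ C := by
    have := (norm_nonneg (c 0)).trans (hc 0)
    simpa using this
  refine ⟨C * B, fun n ↦ ?_⟩
  have hBn : ((n : ℝ) + 1) ^ h * ρ ^ n ≤ B := hB ⟨n, rfl⟩
  calc ‖c n‖ * ρ ^ n ≤ C * ((n : ℝ) + 1) ^ h * ρ ^ n :=
        mul_le_mul_of_nonneg_right (hc n) (pow_nonneg hρ0 n)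
    _ = C * (((n : ℝ) + 1) ^ h * ρ ^ n) := by ring
    _ ≤ C * B := mul_le_mul_of_nonneg_left hBn hC0

/-- **Tempered identity principle at `0`** (§1 fed with §2): a series over a complete field with
`‖c_n‖ ≤ C (n+1)^h` that vanishes at infinitely many non-zero points of a sequence `x_k → 0` is `0`.
[cite: Cassels1986, Ch. 4 Thm. 4.1 (Strassmann; isolated-zeros variant)] [cite: PerrinRiou1994Invent, §1.1] -/
theorem eq_zero_of_tempered_of_hasSum_zero_of_tendsto_zero [CompleteSpace 𝕜] {c : ℕ → 𝕜} {C : ℝ}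
    {h : ℕ} (hc : ∀ n, ‖c n‖ ≤ C * ((n : ℝ) + 1) ^ h) {x : ℕ → 𝕜} (hx : Tendsto x atTop (𝓝 0))
    (h0 : ∃ᶠ k in atTop, x k ≠ 0 ∧ HasSum (fun n ↦ c n * x k ^ n) 0) : c = 0 := by
  obtain ⟨Cρ, hCρ⟩ := exists_norm_mul_pow_le_of_norm_le_mul_pow hc (ρ := 1 / 2) (by norm_num) (by norm_num)
  exact eq_zero_of_hasSum_zero_of_tendsto_zero' (by norm_num) hCρ hx h0

end Tempered

/-! ### §3 Tempered rigidity at a BDP frame -/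

section Frame

variable {p : ℕ} [Fact p.Prime] {K : Type} [Field K] [NumberField K] {N : ℕ}
  {ι : PadicAlgCl p ≃+* ℂ} {𝔭 : HeightOneSpectrum (𝓞 K)} {κ : ZpExtension K p}
  {γ : absoluteGaloisGroup K} {f : CuspForm (CongruenceSubgroup.Gamma0 N) 2} {ΩK : ℂ} {Ωp : ℂ_[p]}

/-- The coefficients of `L ∈ R₀⟦T⟧`, read in `ℂ_p`, satisfy the positive-radius bound at `ρ = 1`, `C = 1`.
[cite: Castella2018, §3 (R₀ ⊂ 𝓞_{ℂ_p})] -/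
theorem norm_coeff_mul_one_pow_le (L : UnrSeries p) (n : ℕ) :
    ‖((PowerSeries.coeff n L : unrIntegers p) : ℂ_[p])‖ * (1 : ℝ) ^ n ≤ 1 := by
  rw [one_pow, mul_one]
  exact norm_coe_unrIntegers_le_one p _

/-- **Two series over `ℂ_p` of positive radius taking equal values on the BDP interpolation range are
equal** (odd `p`; `K` imaginary quadratic; `κ` anticyclotomic with topological generator `γ`; any `ι`). The
hypothesis asks, for every unramified Hecke character `φ` of infinity type `(n, -n)`, `n > 0`, with `p`-adic
avatar `r` factoring through `κ` whose point `x_φ = φ̂(γ) - 1` lies inside BOTH discs of convergence, that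
the two series have a common sum at `x_φ`. The tree's supply `X11b.exists_interpolationSupply` provides such
points accumulating at `0` (`φ₀^{p^k}`: `x = x₀^{p^k} - 1 → 0`, `≠ 0`), and §1 concludes. This is the
TEMPERED form of `X11b.isBDPLFunction_unique_of_isAnticyclotomic` (there both series lie in `R₀⟦T⟧`).
[cite: Castella2018, Thm. 3.1 (arXiv:1704.06608 p. 9)] [cite: Greenberg1987, §2] -/
theorem eq_of_hasSum_bdpRange (hp2 : p ≠ 2) (hK : IsImaginaryQuadratic K) (hκ : κ.IsAnticyclotomic)
    (hγ : κ.IsTopGenerator γ) {c c' : ℕ → ℂ_[p]} {ρ C ρ' C' : ℝ} (hρ : 0 < ρ)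
    (hc : ∀ n, ‖c n‖ * ρ ^ n ≤ C) (hρ' : 0 < ρ') (hc' : ∀ n, ‖c' n‖ * ρ' ^ n ≤ C')
    (h : ∀ (φ : HeckeCharacter K) (n : ℕ), 0 < n → (∀ v : HeightOneSpectrum (𝓞 K), φ.IsUnramifiedAt v) →
      φ.HasInfinityType (fun _ ↦ (n : ℤ)) (fun _ ↦ -(n : ℤ)) →
      ∀ r : FramedGaloisRep K (PadicAlgCl p) 1, IsPAdicAvatarOf ι φ r → FactorsThroughZp κ r →
      ‖avatarValueAt r γ - 1‖ < ρ → ‖avatarValueAt r γ - 1‖ < ρ' →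
      ∃ v : ℂ_[p], HasSum (fun k ↦ c k * (avatarValueAt r γ - 1) ^ k) v ∧
        HasSum (fun k ↦ c' k * (avatarValueAt r γ - 1) ^ k) v) :
    c = c' := by
  obtain ⟨φ, n, r, hn, hunr, hinf, hav, hfac, hlim, hne⟩ :=
    exists_interpolationSupply hp2 ι K κ hK hκ γ hγ
  set x : ℕ → ℂ_[p] := fun k ↦ avatarValueAt (r k) γ - 1 with hx_def
  have hx : Tendsto x atTop (𝓝 0) := by
    rw [← sub_self (1 : ℂ_[p])]
    exact hlim.sub_const 1
  have hρρ : ∀ᶠ k in atTop, ‖x k‖ < ρ ∧ ‖x k‖ < ρ' := by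
    have hball : Metric.ball (0 : ℂ_[p]) (min ρ ρ') ∈ 𝓝 (0 : ℂ_[p]) :=
      Metric.ball_mem_nhds 0 (lt_min hρ hρ')
    filter_upwards [hx.eventually hball] with k hk
    have hk' : ‖x k‖ < min ρ ρ' := by simpa [Metric.mem_ball, dist_zero_right] using hk
    exact lt_min_iff.mp hk'
  refine eq_of_hasSum_eq_of_tendsto_zero hρ hc hρ' hc' hx ?_
  refine ((Filter.Eventually.of_forall fun k ↦ sub_ne_zero.mpr (hne k)).and hρρ).frequently.mono ?_
  rintro k ⟨hk0, hk, hk'⟩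
  exact ⟨hk0, h (φ k) (n k) (hn k) (hunr k) (hinf k) (r k) (hav k) (hfac k) hk hk'⟩

/-- **TEMPERED FRAME RIGIDITY: a series over `ℂ_p` of positive radius with Castella's interpolation
property is the frame's `L`.** Odd `p`; `K` imaginary quadratic; `κ` anticyclotomic with topological
generator `γ`; `L ∈ R₀⟦T⟧` with `IsBDPLFunction ι 𝔭 κ γ f Ω_K Ω_p L`. If `‖c_n‖ ρ^n ≤ C` (`ρ > 0`; e.g. a
tempered series, §2) and at every interpolation point `x_φ = φ̂(γ) - 1` with `‖x_φ‖ < ρ` the series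
`∑ c_k x_φ^k` sums to Castella's value `ι⁻¹(bdpInterpolationValue p f 𝔭 φ n Ω_K) · Ω_p^{4n}`, then
`c_n = [Tⁿ]L` for every `n`: a tempered solution of the interpolation problem is automatically the bounded
one with coefficients in `R₀`. This is the kernel form of the K1 lead's (U2) for stub A's reciprocity step:
a tempered `Col♮(loc_𝔭 κ♮)·m` with the BDP interpolation property IS `ℒ_𝔭^{BDP}`, pinned on the type-`(n,-n)`
range with no appeal to finite-order characters. [cite: Castella2018, Thm. 3.1 (arXiv:1704.06608 p. 9)]
[cite: Greenberg1987, §2] -/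
theorem eq_coeff_of_isBDPLFunction_of_hasSum (hp2 : p ≠ 2) (hK : IsImaginaryQuadratic K)
    (hκ : κ.IsAnticyclotomic) (hγ : κ.IsTopGenerator γ) {L : UnrSeries p}
    (hL : IsBDPLFunction ι 𝔭 κ γ f ΩK Ωp L) {c : ℕ → ℂ_[p]} {ρ C : ℝ} (hρ : 0 < ρ)
    (hc : ∀ n, ‖c n‖ * ρ ^ n ≤ C)
    (h : ∀ (φ : HeckeCharacter K) (n : ℕ), 0 < n → (∀ v : HeightOneSpectrum (𝓞 K), φ.IsUnramifiedAt v) →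
      φ.HasInfinityType (fun _ ↦ (n : ℤ)) (fun _ ↦ -(n : ℤ)) →
      ∀ r : FramedGaloisRep K (PadicAlgCl p) 1, IsPAdicAvatarOf ι φ r → FactorsThroughZp κ r →
      ‖avatarValueAt r γ - 1‖ < ρ →
      HasSum (fun k ↦ c k * (avatarValueAt r γ - 1) ^ k)
        (((ι.symm (bdpInterpolationValue p f 𝔭 φ n ΩK) : PadicAlgCl p) : ℂ_[p]) * Ωp ^ (4 * n))) :
    c = fun k ↦ ((PowerSeries.coeff k L : unrIntegers p) : ℂ_[p]) := by
  refine eq_of_hasSum_bdpRange (ι := ι) hp2 hK hκ hγ hρ hc one_pos (norm_coeff_mul_one_pow_le L) ?_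
  intro φ n hn hunr hinf r hr hfac hlt _hlt'
  exact ⟨_, h φ n hn hunr hinf r hr hfac hlt, hL.hasValueAt hn hunr hinf hr hfac⟩

/-- **Tempered frame rigidity, `𝓗_h` shape**: the previous theorem for a series with `‖c_n‖ ≤ C (n+1)^h`,
the interpolation property being asked at every interpolation point of the open unit disc (all of them:
`‖φ̂(γ) - 1‖ < 1`, tree `norm_avatarValueAt_sub_one_lt`). [cite: Castella2018, Thm. 3.1 (arXiv:1704.06608 p. 9)]
[cite: PerrinRiou1994Invent, §1.1] -/
theorem eq_coeff_of_isBDPLFunction_of_tempered (hp2 : p ≠ 2) (hK : IsImaginaryQuadratic K)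
    (hκ : κ.IsAnticyclotomic) (hγ : κ.IsTopGenerator γ) {L : UnrSeries p}
    (hL : IsBDPLFunction ι 𝔭 κ γ f ΩK Ωp L) {c : ℕ → ℂ_[p]} {C : ℝ} {h : ℕ}
    (hc : ∀ n, ‖c n‖ ≤ C * ((n : ℝ) + 1) ^ h)
    (hint : ∀ (φ : HeckeCharacter K) (n : ℕ), 0 < n → (∀ v : HeightOneSpectrum (𝓞 K), φ.IsUnramifiedAt v) →
      φ.HasInfinityType (fun _ ↦ (n : ℤ)) (fun _ ↦ -(n : ℤ)) →
      ∀ r : FramedGaloisRep K (PadicAlgCl p) 1, IsPAdicAvatarOf ι φ r → FactorsThroughZp κ r →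
      HasSum (fun k ↦ c k * (avatarValueAt r γ - 1) ^ k)
        (((ι.symm (bdpInterpolationValue p f 𝔭 φ n ΩK) : PadicAlgCl p) : ℂ_[p]) * Ωp ^ (4 * n))) :
    c = fun k ↦ ((PowerSeries.coeff k L : unrIntegers p) : ℂ_[p]) := by
  obtain ⟨Cρ, hCρ⟩ := exists_norm_mul_pow_le_of_norm_le_mul_pow hc (ρ := 1 / 2) (by norm_num) (by norm_num)
  exact eq_coeff_of_isBDPLFunction_of_hasSum hp2 hK hκ hγ hL (by norm_num) hCρ
    fun φ n hn hunr hinf r hr hfac _ ↦ hint φ n hn hunr hinf r hr hfac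

/-- **Consequently a tempered solution is bounded by `1`** (it has coefficients in `R₀`).
[cite: Castella2018, Thm. 3.1 and §3 (R₀)] -/
theorem norm_le_one_of_isBDPLFunction_of_tempered (hp2 : p ≠ 2) (hK : IsImaginaryQuadratic K)
    (hκ : κ.IsAnticyclotomic) (hγ : κ.IsTopGenerator γ) {L : UnrSeries p}
    (hL : IsBDPLFunction ι 𝔭 κ γ f ΩK Ωp L) {c : ℕ → ℂ_[p]} {C : ℝ} {h : ℕ}
    (hc : ∀ n, ‖c n‖ ≤ C * ((n : ℝ) + 1) ^ h)
    (hint : ∀ (φ : HeckeCharacter K) (n : ℕ), 0 < n → (∀ v : HeightOneSpectrum (𝓞 K), φ.IsUnramifiedAt v) →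
      φ.HasInfinityType (fun _ ↦ (n : ℤ)) (fun _ ↦ -(n : ℤ)) →
      ∀ r : FramedGaloisRep K (PadicAlgCl p) 1, IsPAdicAvatarOf ι φ r → FactorsThroughZp κ r →
      HasSum (fun k ↦ c k * (avatarValueAt r γ - 1) ^ k)
        (((ι.symm (bdpInterpolationValue p f 𝔭 φ n ΩK) : PadicAlgCl p) : ℂ_[p]) * Ωp ^ (4 * n)))
    (n : ℕ) : ‖c n‖ ≤ 1 := by
  rw [eq_coeff_of_isBDPLFunction_of_tempered hp2 hK hκ hγ hL hc hint]
  exact norm_coe_unrIntegers_le_one p _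

end Frame

end Summit.BirchSwinnertonDyer.BirchSwinnertonDyer.Theorems.CumulativeHeegnerInclusionAtThreeTemperedRigidity

end
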